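import Literature.MathematicalPhysics.QuantumFieldTheory.Balaban1983to89.B6Lemma21TowerD2

/-!
# `Balaban1983to89.B6Ineq258TowerD2` — T. Bałaban, *Propagators and renormalization transformations for lattice gauge
# theories. II*, Commun. Math. Phys. **96** (1984) 223–250 [Balaban1984PropagatorsII], the geometric count (2.58) p.233:
# typed VERBATIM, its printed consequence (2.58) + (2.59) ⇒ (2.61) kernel-checked, and (2.58) REFUTED AS PRINTED on the
# two-level tower family of `B6LevelTower` / `B6Lemma21TowerD2` (d = 2)

statement-level skeleton of published theorems with citation tags; proofs where landed; nothing here is a claim about the Yang–Mills mass gap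

PDF held: `paper:balaban1984-cmp96-propagators-rt-ii` (journal page = PDF page + 222); p. 233 [PDF 11] read as the image
`b2b-balaban-ref1/pages/1984-cmp96-propagators-rt-II/1984-cmp96-propagators-rt-II-p011-x2.png` for this file.

CITATION HEADER (lean-in-tree rule).  WHAT IS REPRODUCED: lit-balaban SKELETON row **B6.Eq2.56** ((2.56)–(2.58) p. 233),
the display (2.58), verbatim: *"We get  Σ_{y′∈𝔅} e^{−αδ₀d(y,y′)} = Σ_{j′=0}^{k} Σ_{y′∈Λ_{j′}} e^{−αδ₀d(y,y′)}
≤ Σ_{j′=0}^{k} Σ_{m=max{|j−j′|−1,0}}^{∞} e^{−½αδ₀mRM} Σ_{z_l,z′_l,l=1,…,m, z_{m+1}∈ℤ^d} e^{−½αδ₀|s(y)−z₁|}e^{−½αδ₀|z₁−z′₁|}·…·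
e^{−½αδ₀|z′_m−z_{m+1}|} = Σ_{j′=0}^{k} Σ_{m=max{|j−j′|−1,0}}^{∞} e^{−½αδ₀mRM}(c₀(½α))^{d(2m+1)},  (2.58)  where s(y) denotes
a scaled image of y on unit lattice, and c₀(α) = Σ_{z∈ℤ} e^{−αδ₀|z|} …  Now we require that RM is sufficiently large, i.e.
we assume ¼αδ₀RM > 2d log c₀(½α) + 1. (2.59)  Then the sum over m can be estimated by c₀^d(½α)e^{−¼αδ₀RM max{|j−j′|−1,0}}
Σ_{m=0}^{∞} e^{−m} ≤ 6c₀^d(½α)e^{−|j−j′|}.  The summation over j′ gives finally the constant 12c₀^d(½α) = c₁(α)."*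
(y ∈ Λ_j; the final inequality is (2.61) of Lemma 2.1.)  STATE OF THE TREE: the ARITHMETIC of the last two sentences
is kernel-checked (`B6Lemma21Arith.inner_sum_le` / `ineq258_sum_le_c1`, `B6.lemma21_constant`-chain); the COUNT (2.58)
is proved in its REPAIRED forms ((2.58′)/(2.58″): `B6Lemma21Bridge.ineq258Branched_summable_and_le` on every geometry
carrying the decomposition data (2.47)/(2.48)/(2.57), `B6TowerDecomp` on towers, `B6Lemma21TwoScale`), with three located
defects of the printed count (GAPS G-A11-1 last leg, G-A13-1 two-scale surface legs, G-A16-1 branch multiplicity); the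
printed conclusion (2.61) with c₁(α) = 12c₀(½α)^d is refuted on the d = 2 tower family (`B6Lemma21TowerD2.tower_sum_gt_c1`,
row B6.Lem2.1, ref-4 g13 #7).  THIS FILE: (i) types (2.58) VERBATIM as `Ineq258Printed d δ₀ α g` over the abstract
`B6.Geometry` (the infinite m-series as a real `tsum`, guarded by its summability so that a divergent right-hand side —
«+∞» in print — makes the display vacuously true, never false); (ii) proves the print's own implication
**(2.58) ∧ (2.59) ⇒ (2.61)** (`ineq261_of_ineq258Printed`: under (2.59) the series converge, `summable_series258`, and the
right-hand side of (2.58) is ≤ c₁(α), `rhs258_le_c1`); (iii) concludes **`not_ineq258Printed_tower`**: on the two-level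
tower `twGeo 2 1 A 1100 1024 η 1100` (k = 1, L = 1024, R = M = 1100, (2.59) verified `B6Lemma21TowerD2.cond259_tower`)
the printed (2.58) FAILS at the base point for αδ₀ = 1/128 — because its right-hand side is ≤ c₁(α) < the row sum
(`tower_sum_gt_c1`); `exists_not_ineq258Printed_tower`: for every δ₀ > 1/128 some admissible α ∈ ]0,1[ with (2.59).
Unit `lit-balaban-r03` (B6 reader/owner, gen 6), PHASE 2, HOME `run/shared/lean/pub/lit-balaban/`, 2026-08-21.  IMPORTS
`…B6Lemma21TowerD2` (→ `…B6Lemma21Arith`, `…B6LevelTower`, `…B6`) BY NAME; ONE new definition-with-body family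
(`term258`/`series258`/`rhs258`/`Ineq258Printed` = the printed display), no new named fact, 0 sorry.

## Honest scope

(i) The refutation is of the DISPLAY (2.58) as a bound on the row sum, on the coordinatised tower model of the nested
geometry (2.1) (k = 1; (2.2) vacuous for k = 1 exactly as in print; the same family and parameters as the endorsed
refutation of (2.61), row B6.Lem2.1); it locates nothing new — the cause is the one recorded in GAPS G-A11-1/G-A13-1 (the
finer level next to a surface is reached at two-scale cost).  (ii) The repaired counts are NOT re-proved here (they are
theorems of `B6Lemma21Bridge`/`B6TowerDecomp`/`B6Lemma21TwoScale`); all consumers of Lemma 2.1 use c₁ only as an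
α-dependent O(1).  (iii) Value = kernel certificate for a located display of [Balaban1984PropagatorsII]; NOT summit
progress, NOT continuum, NOT Clay.
-/

namespace Literature.MathematicalPhysics.QuantumFieldTheory.Balaban1983to89.B6Ineq258TowerD2

open Finset Real
open B6Lemma21Arith (m0 inner_sum_le exp_neg_m0_le tsum_int_exp_neg_abs summable_int_exp_neg_abs
  lemma21_constant_le_twelve one_le_c0 cond259_iff_A)
open B6LevelTower (TW lvl tdist twGeo)
open B6Lemma21TowerD2 (baseY tower_sum_gt_c1 cond259_tower)

noncomputable section

/-! ## §1. The display (2.58), verbatim -/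

/-- The m-th term of the right-hand side of (2.58): `e^{−½αδ₀mRM}(c₀(½α))^{d(2m+1)}`.
[cite: Balaban1984PropagatorsII, (2.58) p.233] -/
def term258 (d : ℕ) (δ₀ α R M : ℝ) (m : ℕ) : ℝ :=
  Real.exp (-(1 / 2 * α * δ₀ * (m : ℝ) * R * M)) * B6.c0 δ₀ (α / 2) ^ (d * (2 * m + 1))

/-- The m-series of (2.58) for the pair of scales (j, j′): the terms with `m ≥ max{|j−j′|−1, 0}` (the others absent).
[cite: Balaban1984PropagatorsII, (2.58) p.233] -/
def series258 (d : ℕ) (δ₀ α R M : ℝ) (j j' : ℕ) (m : ℕ) : ℝ :=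
  if max (|(j : ℤ) - j'| - 1) 0 ≤ (m : ℤ) then term258 d δ₀ α R M m else 0

/-- The right-hand side of (2.58) for `y ∈ Λ_j`: `Σ_{j′=0}^{k} Σ_{m=max{|j−j′|−1,0}}^{∞} e^{−½αδ₀mRM}(c₀(½α))^{d(2m+1)}`.
[cite: Balaban1984PropagatorsII, (2.58) p.233] -/
def rhs258 (d : ℕ) (δ₀ α : ℝ) (g : B6.Geometry) (j : ℕ) : ℝ :=
  ∑ j' ∈ Finset.range (g.k + 1), ∑' m : ℕ, series258 d δ₀ α g.R g.M j j' m

/-- **(2.58) AS PRINTED** (p. 233), for the multiscale geometry `g` (𝔅 = `g.Site`, d(y,y′) = `g.dist`, Λ_j ∋ y with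
j = `g.scale y`, scales 0, …, k = `g.k`, the parameters R, M of (2.1)–(2.2)): for every y ∈ 𝔅,
`Σ_{y′∈𝔅} e^{−αδ₀d(y,y′)} ≤ Σ_{j′=0}^{k} Σ_{m ≥ max{|j−j′|−1,0}} e^{−½αδ₀mRM}(c₀(½α))^{d(2m+1)}` — the infinite m-series typed as
real `tsum`s under the guard that they converge (a divergent right-hand side, «= +∞», makes the printed display true;
under (2.59) they always converge, `summable_series258`). [cite: Balaban1984PropagatorsII, (2.58) p.233] -/
def Ineq258Printed (d : ℕ) (δ₀ α : ℝ) (g : B6.Geometry) : Prop :=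
  ∀ y : g.Site, (∀ j' : ℕ, Summable (series258 d δ₀ α g.R g.M (g.scale y) j')) →
    ∑ y' : g.Site, Real.exp (-(α * δ₀ * g.dist y y')) ≤ rhs258 d δ₀ α g (g.scale y)

/-! ## §2. The arithmetic of p. 233: under (2.59) the series converge and the right-hand side of (2.58) is `≤ c₁(α)` -/

section Arithmetic

variable {d : ℕ} {δ₀ α R M : ℝ}

/-- the summation floor of (2.58) is `B6Lemma21Arith.m0 (j − j′) = max{|j−j′|−1, 0}`.
[cite: Balaban1984PropagatorsII, (2.58) p.233 «m = max{|j−j′|−1,0}»] [folklore] -/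
theorem floor_iff (j j' m : ℕ) : max (|(j : ℤ) - j'| - 1) 0 ≤ (m : ℤ) ↔ m0 ((j : ℤ) - j') ≤ m := by
  unfold m0
  rw [max_le_iff, Int.toNat_le]
  constructor
  · rintro ⟨h, _⟩; exact h
  · intro h; exact ⟨h, by positivity⟩

/-- the terms of (2.58) in the shape of `B6Lemma21Arith.inner_sum_le`: `e^{−A m}c^{2m+1}`, `A = ½αδ₀RM`, `c = c₀(½α)^d`.
[cite: Balaban1984PropagatorsII, (2.58)–(2.59) p.233] -/
theorem term258_eq (m : ℕ) :
    term258 d δ₀ α R M m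
      = Real.exp (-((1 / 2 * α * δ₀ * R * M) * (m : ℝ))) * (B6.c0 δ₀ (α / 2) ^ d) ^ (2 * m + 1) := by
  unfold term258
  rw [← pow_mul]
  congr 2
  ring

/-- the m-series of (2.58) is the shifted series `n ↦ term(m₀ + n)`, `m₀ = max{|j−j′|−1,0}` (reindexing `m = m₀ + n`).
[cite: Balaban1984PropagatorsII, (2.58) p.233] [folklore] -/
theorem tsum_series258_eq (j j' : ℕ) :
    ∑' m : ℕ, series258 d δ₀ α R M j j' m = ∑' n : ℕ, term258 d δ₀ α R M (m0 ((j : ℤ) - j') + n) := by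
  set m₀ := m0 ((j : ℤ) - j') with hm₀
  have hinj : Function.Injective (fun n : ℕ => m₀ + n) := fun a b h => by simpa using h
  have hsupp : Function.support (series258 d δ₀ α R M j j') ⊆ Set.range (fun n : ℕ => m₀ + n) := by
    intro m hm
    rw [Function.mem_support] at hm
    unfold series258 at hm
    by_cases h : max (|(j : ℤ) - j'| - 1) 0 ≤ (m : ℤ)
    · have h' := (floor_iff j j' m).1 h
      exact ⟨m - m₀, Nat.add_sub_of_le h'⟩
    · exact absurd (if_neg h) hm
  rw [← hinj.tsum_eq hsupp]
  refine tsum_congr fun n => ?_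
  show series258 d δ₀ α R M j j' (m₀ + n) = _
  unfold series258
  rw [if_pos ((floor_iff j j' _).2 (by omega))]

/-- the shifted series is geometric: `term(m₀+n) = term(m₀)·qⁿ` with `q = e^{−A}c²`.
[cite: Balaban1984PropagatorsII, (2.58) p.233] [folklore] -/
private theorem term258_shift (m₀ n : ℕ) :
    term258 d δ₀ α R M (m₀ + n)
      = term258 d δ₀ α R M m₀ * (Real.exp (-(1 / 2 * α * δ₀ * R * M)) * (B6.c0 δ₀ (α / 2) ^ d) ^ 2) ^ n := by
  rw [term258_eq, term258_eq, mul_pow, ← Real.exp_nat_mul, ← pow_mul]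
  have hexp : Real.exp (-(1 / 2 * α * δ₀ * R * M * ((m₀ + n : ℕ) : ℝ)))
      = Real.exp (-(1 / 2 * α * δ₀ * R * M * (m₀ : ℝ))) * Real.exp ((n : ℝ) * -(1 / 2 * α * δ₀ * R * M)) := by
    rw [← Real.exp_add]
    congr 1
    push_cast
    ring
  rw [hexp, show 2 * (m₀ + n) + 1 = (2 * m₀ + 1) + 2 * n by ring, pow_add]
  ring

/-- **under (2.59) the m-series of (2.58) converge** (ratio `e^{−½αδ₀RM}c₀(½α)^{2d} < e^{−1}`).
[cite: Balaban1984PropagatorsII, (2.58)–(2.59) p.233] -/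
theorem summable_series258 (hα : 0 < α) (hδ : 0 < δ₀) (h259 : B6.Cond259 d δ₀ α R M) (j j' : ℕ) :
    Summable (series258 d δ₀ α R M j j') := by
  set m₀ := m0 ((j : ℤ) - j') with hm₀
  have hc0 : 1 ≤ B6.c0 δ₀ (α / 2) := one_le_c0 (by positivity)
  have hc : 1 ≤ B6.c0 δ₀ (α / 2) ^ d := one_le_pow₀ hc0
  have hA := (cond259_iff_A (d := d) (R := R) (M := M)).1 h259
  set c := B6.c0 δ₀ (α / 2) ^ d with hcdef
  -- the ratio q = e^{−A}c² < 1 under (2.59)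
  set q := Real.exp (-(1 / 2 * α * δ₀ * R * M)) * c ^ 2 with hq
  have hlogc : 0 ≤ Real.log c := Real.log_nonneg hc
  have hcpos : 0 < c := by linarith
  have hq0 : 0 ≤ q := by positivity
  have hq1 : q < 1 := by
    have hq' : q = Real.exp (-(1 / 2 * α * δ₀ * R * M) + Real.log (c ^ 2)) := by
      rw [hq, Real.exp_add, Real.exp_log (by positivity)]
    rw [hq', Real.exp_lt_one_iff, Real.log_pow]
    push_cast
    linarith
  -- the shifted series is term(m₀)·qⁿ, summable; pull back along the injective shift
  have hshift : Summable fun n : ℕ => term258 d δ₀ α R M (m₀ + n) := by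
    have : (fun n : ℕ => term258 d δ₀ α R M (m₀ + n)) = fun n => term258 d δ₀ α R M m₀ * q ^ n := by
      funext n; rw [term258_shift]
    rw [this]
    exact (summable_geometric_of_lt_one hq0 hq1).mul_left _
  have hinj : Function.Injective (fun n : ℕ => m₀ + n) := fun a b h => by simpa using h
  have hzero : ∀ m ∉ Set.range (fun n : ℕ => m₀ + n), series258 d δ₀ α R M j j' m = 0 := by
    intro m hm
    unfold series258
    rw [if_neg]
    intro h
    exact hm ⟨m - m₀, by have := (floor_iff j j' m).1 h; simp only; omega⟩
  rw [← hinj.summable_iff hzero]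
  have : (series258 d δ₀ α R M j j' ∘ fun n : ℕ => m₀ + n) = fun n => term258 d δ₀ α R M (m₀ + n) := by
    funext n
    simp only [Function.comp]
    unfold series258
    rw [if_pos ((floor_iff j j' _).2 (by omega))]
  rw [this]
  exact hshift

/-- the inner m-series of (2.58) is `≤ (c₀(½α)^d·e/(1 − e^{−1}))·e^{−|j−j′|}` under (2.59) — the print's *"the sum over m
can be estimated by c₀^d(½α)e^{−¼αδ₀RM max{|j−j′|−1,0}}Σ_m e^{−m} ≤ 6c₀^d(½α)e^{−|j−j′|}"* with the true constant
e²/(e−1) = 4.30… (`B6Lemma21Arith.inner_sum_le`, `exp_neg_m0_le`). [cite: Balaban1984PropagatorsII, p.233] -/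
theorem tsum_series258_le (hα : 0 < α) (hδ : 0 < δ₀) (h259 : B6.Cond259 d δ₀ α R M) (j j' : ℕ) :
    ∑' m : ℕ, series258 d δ₀ α R M j j' m
      ≤ (B6.c0 δ₀ (α / 2) ^ d * Real.exp 1 / (1 - Real.exp (-1))) * Real.exp (-|(((j : ℤ) - j' : ℤ) : ℝ)|) := by
  have hc0 : 1 ≤ B6.c0 δ₀ (α / 2) := one_le_c0 (by positivity)
  have hc : 1 ≤ B6.c0 δ₀ (α / 2) ^ d := one_le_pow₀ hc0
  set c := B6.c0 δ₀ (α / 2) ^ d with hcdef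
  have hA := (cond259_iff_A (d := d) (R := R) (M := M)).1 h259
  rw [← hcdef] at hA
  have hden : 0 < 1 - Real.exp (-1) := by
    have : Real.exp (-1) < 1 := by rw [Real.exp_lt_one_iff]; norm_num
    linarith
  rw [tsum_series258_eq]
  have hre : (fun n : ℕ => term258 d δ₀ α R M (m0 ((j : ℤ) - j') + n))
      = fun n : ℕ => Real.exp (-((1 / 2 * α * δ₀ * R * M) * ((m0 ((j : ℤ) - j') + n : ℕ) : ℝ)))
          * c ^ (2 * (m0 ((j : ℤ) - j') + n) + 1) := by
    funext n; rw [term258_eq]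
  rw [hre]
  calc _ ≤ c * Real.exp (-((m0 ((j : ℤ) - j') : ℕ) : ℝ)) / (1 - Real.exp (-1)) := inner_sum_le hc hA _
    _ ≤ (c * Real.exp 1 / (1 - Real.exp (-1))) * Real.exp (-|(((j : ℤ) - j' : ℤ) : ℝ)|) := by
        have := exp_neg_m0_le ((j : ℤ) - j')
        rw [div_mul_eq_mul_div, mul_assoc]
        apply div_le_div_of_nonneg_right _ hden.le
        exact mul_le_mul_of_nonneg_left this (by linarith)

/-- the j′-sum of (2.58) over the scales `0, …, k` is at most the two-sided sum `Σ_{z∈ℤ} e^{−|z|} = (1+e^{−1})/(1−e^{−1})`.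
[cite: Balaban1984PropagatorsII, p.233 «The summation over j′ gives finally the constant 12c₀^d(½α)»] [folklore] -/
theorem sum_range_exp_le (k j : ℕ) :
    ∑ j' ∈ Finset.range (k + 1), Real.exp (-|(((j : ℤ) - j' : ℤ) : ℝ)|)
      ≤ (1 + Real.exp (-1)) / (1 - Real.exp (-1)) := by
  rw [← tsum_int_exp_neg_abs]
  have hinj : Set.InjOn (fun j' : ℕ => (j : ℤ) - j') ↑(Finset.range (k + 1)) := by
    intro a _ b _ h; simpa using h
  calc ∑ j' ∈ Finset.range (k + 1), Real.exp (-|(((j : ℤ) - j' : ℤ) : ℝ)|)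
      = ∑ z ∈ (Finset.range (k + 1)).image (fun j' : ℕ => (j : ℤ) - j'), Real.exp (-|(z : ℝ)|) := by
        rw [Finset.sum_image hinj]
    _ ≤ ∑' z : ℤ, Real.exp (-|(z : ℝ)|) :=
        (summable_int_exp_neg_abs).sum_le_tsum _ (fun _ _ => (Real.exp_pos _).le)

/-- **the right-hand side of (2.58) is `≤ c₁(α) = 12c₀(½α)^d` under (2.59)** (the last two sentences of p. 233, kernel
arithmetic of `B6Lemma21Arith`). [cite: Balaban1984PropagatorsII, (2.58)–(2.59) p.233, Lemma 2.1 (2.61) p.234] -/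
theorem rhs258_le_c1 (hα : 0 < α) (hδ : 0 < δ₀) (g : B6.Geometry) (h259 : B6.Cond259 d δ₀ α g.R g.M) (j : ℕ) :
    rhs258 d δ₀ α g j ≤ B6.c1 d δ₀ α := by
  have hc0 : 1 ≤ B6.c0 δ₀ (α / 2) := one_le_c0 (by positivity)
  have hc : 1 ≤ B6.c0 δ₀ (α / 2) ^ d := one_le_pow₀ hc0
  set c := B6.c0 δ₀ (α / 2) ^ d with hcdef
  have hden : 0 < 1 - Real.exp (-1) := by
    have : Real.exp (-1) < 1 := by rw [Real.exp_lt_one_iff]; norm_num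
    linarith
  have hK : 0 ≤ c * Real.exp 1 / (1 - Real.exp (-1)) := by positivity
  unfold rhs258
  calc _ ≤ ∑ j' ∈ Finset.range (g.k + 1),
          (c * Real.exp 1 / (1 - Real.exp (-1))) * Real.exp (-|(((j : ℤ) - j' : ℤ) : ℝ)|) :=
        Finset.sum_le_sum fun j' _ => tsum_series258_le hα hδ h259 j j'
    _ = (c * Real.exp 1 / (1 - Real.exp (-1)))
          * ∑ j' ∈ Finset.range (g.k + 1), Real.exp (-|(((j : ℤ) - j' : ℤ) : ℝ)|) := by rw [Finset.mul_sum]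
    _ ≤ (c * Real.exp 1 / (1 - Real.exp (-1))) * ((1 + Real.exp (-1)) / (1 - Real.exp (-1))) :=
        mul_le_mul_of_nonneg_left (sum_range_exp_le _ _) hK
    _ = c * (Real.exp 1 / (1 - Real.exp (-1)) * ((1 + Real.exp (-1)) / (1 - Real.exp (-1)))) := by ring
    _ ≤ c * 12 := mul_le_mul_of_nonneg_left lemma21_constant_le_twelve (by linarith)
    _ = B6.c1 d δ₀ α := by rw [B6.c1, hcdef]; ring

/-- **(2.58) ∧ (2.59) ⇒ (2.61)** — the print's own step from the count to Lemma 2.1: if the display (2.58) holds on `g`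
and RM satisfies (2.59), then `Σ_{y′∈𝔅} e^{−αδ₀d(y,y′)} ≤ c₁(α)` for every y.  Hence every refutation of the printed
(2.61) under (2.59) refutes the printed (2.58). [cite: Balaban1984PropagatorsII, (2.58)–(2.61) pp.233–234] -/
theorem ineq261_of_ineq258Printed {g : B6.Geometry} (H : Ineq258Printed d δ₀ α g) (hα : 0 < α) (hδ : 0 < δ₀)
    (h259 : B6.Cond259 d δ₀ α g.R g.M) (y : g.Site) :
    ∑ y' : g.Site, Real.exp (-(α * δ₀ * g.dist y y')) ≤ B6.c1 d δ₀ α :=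
  (H y fun j' => summable_series258 hα hδ h259 _ j').trans (rhs258_le_c1 hα hδ g h259 _)

end Arithmetic

/-! ## §3. (2.58) fails as printed on the two-level tower (d = 2, k = 1, L = 1024, R = M = 1100, αδ₀ = 1/128) -/

section Tower

/-- the box parameter `A = 1024·1537` of `B6Lemma21TowerD2`. -/
local notation "𝔸" => (1573888 : ℕ)

/-- **(2.58) IS FALSE AS PRINTED on the tower family**: for `α, δ₀ > 0` with `αδ₀ = 1/128` the display (2.58) fails on
the two-level tower `twGeo 2 1 A 1100 1024 η 1100` (any η) — (2.59) holds there (`B6Lemma21TowerD2.cond259_tower`), so the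
right-hand side of (2.58) is at most `c₁(α)` (`rhs258_le_c1`), while the row sum at the base point exceeds `c₁(α)`
(`B6Lemma21TowerD2.tower_sum_gt_c1`). [cite: Balaban1984PropagatorsII, (2.58) p.233] -/
theorem not_ineq258Printed_tower {δ₀ α : ℝ} (hα : 0 < α) (hδ : 0 < δ₀) (h : α * δ₀ = 1 / 128) (η : ℝ) :
    ¬ Ineq258Printed 2 δ₀ α (twGeo 2 1 𝔸 1100 1024 η 1100) := by
  intro H
  have hcond : B6.Cond259 2 δ₀ α (twGeo 2 1 𝔸 1100 1024 η 1100).R (twGeo 2 1 𝔸 1100 1024 η 1100).M := by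
    have := cond259_tower h
    simpa using this
  have h1 := ineq261_of_ineq258Printed H hα hδ hcond baseY
  have h2 := tower_sum_gt_c1 h
  exact absurd (lt_of_lt_of_le h2 h1) (lt_irrefl _)

/-- **for every δ₀ > 1/128 the printed (2.58) fails on the tower for an admissible α**: α := 1/(128δ₀) ∈ ]0, 1[ (the range
«with arbitrary 0 < α < 1» of p. 233), (2.59) holds for the tower's R = M = 1100, and (2.58) is false.
[cite: Balaban1984PropagatorsII, (2.58)–(2.59) p.233] -/
theorem exists_not_ineq258Printed_tower {δ₀ : ℝ} (hδ : 1 / 128 < δ₀) (η : ℝ) :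
    ∃ α : ℝ, 0 < α ∧ α < 1 ∧ B6.Cond259 2 δ₀ α 1100 1100 ∧
      ¬ Ineq258Printed 2 δ₀ α (twGeo 2 1 𝔸 1100 1024 η 1100) := by
  have hδ0 : 0 < δ₀ := lt_trans (by norm_num) hδ
  refine ⟨1 / (128 * δ₀), by positivity, ?_, ?_, ?_⟩
  · rw [div_lt_one (by positivity)]; linarith
  · exact cond259_tower (by field_simp)
  · exact not_ineq258Printed_tower (by positivity) hδ0 (by field_simp) η

/-- the guard of `Ineq258Printed` is met on the tower (the m-series converge there), so the failure is a failure of the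
INEQUALITY (2.58), not of convergence. [cite: Balaban1984PropagatorsII, (2.58)–(2.59) p.233] -/
theorem summable_series258_tower {δ₀ α : ℝ} (hα : 0 < α) (hδ : 0 < δ₀) (h : α * δ₀ = 1 / 128) (j j' : ℕ) :
    Summable (series258 2 δ₀ α 1100 1100 j j') :=
  summable_series258 hα hδ (cond259_tower h) j j'

end Tower

end

end Literature.MathematicalPhysics.QuantumFieldTheory.Balaban1983to89.B6Ineq258TowerD2
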